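import Summits.RiemannHypothesis.RiemannHypothesis.Theorems.JensenPolynomialsPhiLogDerivEnvelopeCore
import HarnessLib

/-!
# Route `JensenPolynomials`, far skewness crux `XiCumulantSkew98Far` — the envelopes (E3), (E4) of `ψ‴`, `ψ⁗`
(`ψ = −log Φ`; RH-FREE; cell rh-jensen, HUMAN RULING D-0040 / D-0074)

LINE 1 (D-0074 framing): everything here is RH-FREE real analysis of the Pólya–de Bruijn kernel `Φ = deBruijnPhi`;
nothing in this file bears on the zeros of `ζ` or is progress toward RH.

**Main theorems** (BLUEPRINT-19216 §5 (E3)/(E4), the two Φ-inputs of the Stein-hierarchy proof design for the far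
skewness cap `q(M) ≤ 81/2`, crux `XiCumulantSkew98Far`, that were not yet in the tree; (E1)/(E2) are
`neg_deBruijnPhiDeriv_le/ge` and `deBruijnPhi_logConcave_quantitative/upper`). For every `u ≥ 3/2`:

* `le_phiNegLogDeriv₃`, `phiNegLogDeriv₃_le`: `64πe^{4u}(1 − 10⁻⁶) ≤ ψ‴(u) ≤ 64πe^{4u}`;
* `le_phiNegLogDeriv₄`, `phiNegLogDeriv₄_le`: `256πe^{4u} ≤ ψ⁗(u) ≤ 256πe^{4u}(1 + 10⁻⁶)`;
* `phiNegLogDeriv₃_pos`, `phiNegLogDeriv₄_pos`; and the cleared forms `deBruijnPhi_logDeriv₃_bounds`,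
  `deBruijnPhi_logDeriv₄_bounds` (`64πe^{4u}(1 − 10⁻⁶)Φ³ ≤ −Φ²Φ‴ + 3ΦΦ′Φ″ − 2Φ′³ ≤ 64πe^{4u}Φ³`,
  `256πe^{4u}Φ⁴ ≤ 6Φ′⁴ − 12ΦΦ′²Φ″ + 3Φ²Φ″² + 4Φ²Φ′Φ‴ − Φ³Φ⁗ ≤ 256πe^{4u}(1 + 10⁻⁶)Φ⁴`).

(The signs are those of the leading term: `ρ₃ = ψ‴/(64πe^{4u}) − 1 = −6(2y+3)/(2y−3)³ + O(e^{−3y}) < 0`,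
`ρ₄ = ψ⁗/(256πe^{4u}) − 1 = +6(4y²+24y+9)/(2y−3)⁴ + O(e^{−3y}) > 0`, `|ρ₃|, |ρ₄| ≤ 9.43·10⁻⁷` at `u = 3/2`;
the cell's eng-5 g2 certified the same numbers pointwise.) Proof: write the one-series of `Φ, −Φ′, Φ″, Φ‴, Φ⁗` as head
`P_m(y)e^{−y}` plus tail (`JensenPolynomialsPhiThetaTails6`), normalise by `e^{y}`, and apply the algebraic cores
`envelope₃_core`, `envelope₄_core` (`JensenPolynomialsPhiLogDerivEnvelopeCore`).

WHAT THIS IS NOT: not a statement about `ξ`'s zeros; `q(M) ↑ 32` and these envelopes are RH-free asymptotics of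
`ξ`'s Taylor data. References: M. W. Coffey, G. Csordas, Math. Comp. 82 (2013) [CoffeyCsordas2013];
G. Csordas, T. S. Norfolk, R. S. Varga, Trans. AMS 296 (1986) §3 [CsordasNorfolkVarga1986].
-/

noncomputable section

open Filter Set
open scoped Real Topology

-- D-0017: `Summit.RiemannHypothesis.RiemannHypothesis.…` duplicates the namespace BY DESIGN (single-problem summit).
set_option linter.dupNamespace false

namespace Summit.RiemannHypothesis.RiemannHypothesis.Theorems.JensenPolynomials

open Literature.NumberTheory.LFunctions


/-- **(E3) and (E4) of BLUEPRINT-19216 §5.** For `u ≥ 3/2`: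
`64πe^{4u}(1 − 10⁻⁶) ≤ ψ‴(u) ≤ 64πe^{4u}` and `256πe^{4u} ≤ ψ⁗(u) ≤ 256πe^{4u}(1 + 10⁻⁶)` (`ψ = −log Φ`).
Proof: one-series of `Φ, Φ′, Φ″, Φ‴, Φ⁗` = head `P_m(y)e^{−y}` + tail `≤ θ·4^m·2·y^{m+2}e^{−y}` (`y = πe^{4u} ≥ 1267.4`),
then `envelope₃_core` / `envelope₄_core`. -/
theorem phiNegLogDeriv₃₄_bounds {u : ℝ} (hu : 3 / 2 ≤ u) :
    (64 * π * rexp (4 * u) * (1 - 1 / 10 ^ 6) ≤ phiNegLogDeriv₃ u ∧ phiNegLogDeriv₃ u ≤ 64 * π * rexp (4 * u)) ∧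
    (256 * π * rexp (4 * u) ≤ phiNegLogDeriv₄ u ∧
      phiNegLogDeriv₄ u ≤ 256 * π * rexp (4 * u) * (1 + 1 / 10 ^ 6)) := by
  have hx1 : 1 ≤ rexp (4 * u) := Real.one_le_exp (by linarith)
  have hyx : 1267.4 ≤ π * rexp (4 * u) := pi_mul_exp_four_mul_ge hu
  set x := rexp (4 * u) with hxdef
  have hx0 : 0 < x := lt_of_lt_of_le one_pos hx1
  set y := π * x with hydef
  have hy : 1267.4 ≤ y := hyx
  have hy0 : 0 ≤ y := by linarith
  have heu : rexp u ≠ 0 := (Real.exp_pos u).ne'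
  have hey0 : 0 < rexp y := Real.exp_pos y
  have hev : rexp y * rexp (-y) = 1 := by rw [← Real.exp_add, add_neg_cancel, Real.exp_zero]
  -- the five one-series, split into head and tail
  set T₀ := ∑' n, phiPolyTerm (-3) 2 0 0 x (n + 1) with hT₀def
  set T₁ := ∑' n, phiPolyTerm 15 (-30) 8 0 x (n + 1) with hT₁def
  set T₂ := ∑' n, phiPolyTerm (-75) 330 (-224) 32 x (n + 1) with hT₂def
  set T₃ := ∑' n, phiPolyTerm6 (-375) 3270 (-4232) 1440 (-128) 0 x (n + 1) with hT₃def
  set T₄ := ∑' n, phiPolyTerm6 (-1875) 30930 (-68096) 41408 (-8448) 512 x (n + 1) with hT₄def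
  have eS₀ : ∑' n, phiPolyTerm (-3) 2 0 0 x n = (2 * y ^ 2 - 3 * y) * rexp (-y) + T₀ := by
    rw [(summable_phiPolyTerm _ _ _ _ hx0).tsum_eq_zero_add, phiPolyTerm_zero_P0_eq]
  have eS₁ : ∑' n, phiPolyTerm 15 (-30) 8 0 x n = (8 * y ^ 3 - 30 * y ^ 2 + 15 * y) * rexp (-y) + T₁ := by
    rw [(summable_phiPolyTerm _ _ _ _ hx0).tsum_eq_zero_add, phiPolyTerm_zero_P1_eq]
  have eS₂ : ∑' n, phiPolyTerm (-75) 330 (-224) 32 x n =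
      (32 * y ^ 4 - 224 * y ^ 3 + 330 * y ^ 2 - 75 * y) * rexp (-y) + T₂ := by
    rw [(summable_phiPolyTerm _ _ _ _ hx0).tsum_eq_zero_add, phiPolyTerm_zero_P2_eq]
  have eS₃ : ∑' n, phiPolyTerm6 (-375) 3270 (-4232) 1440 (-128) 0 x n =
      (-128 * y ^ 5 + 1440 * y ^ 4 - 4232 * y ^ 3 + 3270 * y ^ 2 - 375 * y) * rexp (-y) + T₃ := by
    rw [tsum_phiPolyTerm6_eq_zero_add _ _ _ _ _ _ hx0, phiPolyTerm6_zero_P3_eq]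
  have eS₄ : ∑' n, phiPolyTerm6 (-1875) 30930 (-68096) 41408 (-8448) 512 x n =
      (512 * y ^ 6 - 8448 * y ^ 5 + 41408 * y ^ 4 - 68096 * y ^ 3 + 30930 * y ^ 2 - 1875 * y) * rexp (-y) +
        T₄ := by
    rw [tsum_phiPolyTerm6_eq_zero_add _ _ _ _ _ _ hx0, phiPolyTerm6_zero_P4_eq]
  -- normalised values `s_m = e^{y}·(series)`
  set s₀ := rexp y * ∑' n, phiPolyTerm (-3) 2 0 0 x n with hs₀def
  set s₁ := rexp y * ∑' n, phiPolyTerm 15 (-30) 8 0 x n with hs₁def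
  set s₂ := rexp y * ∑' n, phiPolyTerm (-75) 330 (-224) 32 x n with hs₂def
  set s₃ := rexp y * ∑' n, phiPolyTerm6 (-375) 3270 (-4232) 1440 (-128) 0 x n with hs₃def
  set s₄ := rexp y * ∑' n, phiPolyTerm6 (-1875) 30930 (-68096) 41408 (-8448) 512 x n with hs₄def
  have d₀ : s₀ - (2 * y ^ 2 - 3 * y) = rexp y * T₀ := by
    rw [hs₀def, eS₀]; linear_combination (2 * y ^ 2 - 3 * y) * hev
  have d₁ : s₁ - (8 * y ^ 3 - 30 * y ^ 2 + 15 * y) = rexp y * T₁ := by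
    rw [hs₁def, eS₁]; linear_combination (8 * y ^ 3 - 30 * y ^ 2 + 15 * y) * hev
  have d₂ : s₂ - (32 * y ^ 4 - 224 * y ^ 3 + 330 * y ^ 2 - 75 * y) = rexp y * T₂ := by
    rw [hs₂def, eS₂]; linear_combination (32 * y ^ 4 - 224 * y ^ 3 + 330 * y ^ 2 - 75 * y) * hev
  have d₃ : s₃ - (-128 * y ^ 5 + 1440 * y ^ 4 - 4232 * y ^ 3 + 3270 * y ^ 2 - 375 * y) = rexp y * T₃ := by
    rw [hs₃def, eS₃]
    linear_combination (-128 * y ^ 5 + 1440 * y ^ 4 - 4232 * y ^ 3 + 3270 * y ^ 2 - 375 * y) * hev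
  have d₄ : s₄ - (512 * y ^ 6 - 8448 * y ^ 5 + 41408 * y ^ 4 - 68096 * y ^ 3 + 30930 * y ^ 2 - 1875 * y) =
      rexp y * T₄ := by
    rw [hs₄def, eS₄]
    linear_combination (512 * y ^ 6 - 8448 * y ^ 5 + 41408 * y ^ 4 - 68096 * y ^ 3 + 30930 * y ^ 2 - 1875 * y) * hev
  -- tails → `θ`
  set θ := 64 / 63 * 4 ^ 6 * rexp (-(3 * y)) with hθdef
  have hθ0 : 0 ≤ θ := (envTheta_pos y).le
  have hθ7 : θ * y ^ 7 ≤ 1 / 10 ^ 6 := envTheta_mul_pow_seven_le hy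
  have tail : ∀ {T C : ℝ} {d : ℕ}, d ≤ 6 → 0 ≤ C →
      |T| ≤ C * (64 / 63 * 4 ^ d * (y ^ d * rexp (-(4 * y)))) → |rexp y * T| ≤ θ * (C * y ^ d) := by
    intro T C d hd hC h
    rw [abs_mul, abs_of_pos hey0]
    exact (mul_le_mul_of_nonneg_left h hey0.le).trans (exp_mul_tail_le_envTheta hC hy0 hd)
  have ht₀0 : 0 ≤ s₀ - (2 * y ^ 2 - 3 * y) := by
    rw [d₀]; exact mul_nonneg hey0.le (tsum_phiPolyTerm_P0_succ_bounds hx1).1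
  have ht₀ : s₀ - (2 * y ^ 2 - 3 * y) ≤ θ * (2 * y ^ 2) := by
    rw [d₀]; exact (le_abs_self _).trans (tail (by norm_num) (by norm_num) (abs_tsum_phiPolyTerm_P0_succ_le hx1))
  have ht₁ : |s₁ - (8 * y ^ 3 - 30 * y ^ 2 + 15 * y)| ≤ θ * (8 * y ^ 3) := by
    rw [d₁]; exact tail (by norm_num) (by norm_num) (abs_tsum_phiPolyTerm_P1_succ_le hx1)
  have ht₂ : |s₂ - (32 * y ^ 4 - 224 * y ^ 3 + 330 * y ^ 2 - 75 * y)| ≤ θ * (32 * y ^ 4) := by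
    rw [d₂]; exact tail (by norm_num) (by norm_num) (abs_tsum_phiPolyTerm_P2_succ_le hx1)
  have ht₃ : |s₃ - (-128 * y ^ 5 + 1440 * y ^ 4 - 4232 * y ^ 3 + 3270 * y ^ 2 - 375 * y)| ≤
      θ * (128 * y ^ 5) := by
    rw [d₃]; exact tail (by norm_num) (by norm_num) (abs_tsum_phiPolyTerm6_P3_succ_le hx1)
  have ht₄ : |s₄ - (512 * y ^ 6 - 8448 * y ^ 5 + 41408 * y ^ 4 - 68096 * y ^ 3 + 30930 * y ^ 2 - 1875 * y)| ≤
      θ * (512 * y ^ 6) := by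
    rw [d₄]; exact tail le_rfl (by norm_num) (abs_tsum_phiPolyTerm6_P4_succ_le hx1)
  obtain ⟨h3l, h3u⟩ := envelope₃_core hy hθ0 hθ7 ht₀0 ht₀ ht₁ ht₂ ht₃
  obtain ⟨h4l, h4u⟩ := envelope₄_core hy hθ0 hθ7 ht₀0 ht₀ ht₁ ht₂ ht₃ ht₄
  -- `ψ‴ = N₃(s)/s₀³`, `ψ⁗ = N₄(s)/s₀⁴`
  have hs0 : 0 < s₀ := by
    have h' : 0 < y * (2 * y - 3) := mul_pos (by linarith) (by linarith)
    linarith only [ht₀0, h']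
  have hS0 : (∑' n, phiPolyTerm (-3) 2 0 0 x n) ≠ 0 := by
    intro h; rw [hs₀def, h, mul_zero] at hs0; exact lt_irrefl _ hs0
  have eΦ : deBruijnPhi u = rexp u * ∑' n, phiPolyTerm (-3) 2 0 0 x n := by rw [hxdef]; exact deBruijnPhi_eq_tsum u
  have eΦ1 : deBruijnPhiDeriv u = -(rexp u * ∑' n, phiPolyTerm 15 (-30) 8 0 x n) := by
    rw [hxdef]; exact deBruijnPhiDeriv_eq_tsum u
  have eΦ2 : deBruijnPhiDeriv₂ u = rexp u * ∑' n, phiPolyTerm (-75) 330 (-224) 32 x n := by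
    rw [hxdef]; exact deBruijnPhiDeriv₂_eq_tsum u
  have eΦ3 : deBruijnPhiDeriv₃ u = rexp u * ∑' n, phiPolyTerm6 (-375) 3270 (-4232) 1440 (-128) 0 x n := by
    rw [hxdef]; exact deBruijnPhiDeriv₃_eq_tsum u
  have eΦ4 : deBruijnPhiDeriv₄ u = rexp u * ∑' n, phiPolyTerm6 (-1875) 30930 (-68096) 41408 (-8448) 512 x n := by
    rw [hxdef]; exact deBruijnPhiDeriv₄_eq_tsum u
  have key3 : phiNegLogDeriv₃ u = (-(s₀ ^ 2 * s₃) - 3 * s₀ * s₁ * s₂ + 2 * s₁ ^ 3) / s₀ ^ 3 := by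
    unfold phiNegLogDeriv₃
    rw [eΦ, eΦ1, eΦ2, eΦ3, hs₀def, hs₁def, hs₂def, hs₃def]
    field_simp
    ring
  have key4 : phiNegLogDeriv₄ u =
      (6 * s₁ ^ 4 - 12 * s₀ * s₁ ^ 2 * s₂ + 3 * s₀ ^ 2 * s₂ ^ 2 - 4 * s₀ ^ 2 * s₁ * s₃ - s₀ ^ 3 * s₄) / s₀ ^ 4 := by
    unfold phiNegLogDeriv₄
    rw [eΦ, eΦ1, eΦ2, eΦ3, eΦ4, hs₀def, hs₁def, hs₂def, hs₃def, hs₄def]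
    field_simp
    ring
  have e64 : (64 : ℝ) * π * x = 64 * y := by rw [hydef]; ring
  have e256 : (256 : ℝ) * π * x = 256 * y := by rw [hydef]; ring
  have hs3 : 0 < s₀ ^ 3 := pow_pos hs0 3
  have hs4 : 0 < s₀ ^ 4 := pow_pos hs0 4
  rw [key3, key4, e64, e256, le_div_iff₀ hs3, div_le_iff₀ hs3, le_div_iff₀ hs4, div_le_iff₀ hs4]
  exact ⟨⟨h3l, h3u⟩, ⟨h4l, h4u⟩⟩

/-- (E3), upper: `ψ‴(u) ≤ 64πe^{4u}` for `u ≥ 3/2`. -/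
theorem phiNegLogDeriv₃_le {u : ℝ} (hu : 3 / 2 ≤ u) : phiNegLogDeriv₃ u ≤ 64 * π * rexp (4 * u) :=
  (phiNegLogDeriv₃₄_bounds hu).1.2

/-- (E3), lower: `64πe^{4u}(1 − 10⁻⁶) ≤ ψ‴(u)` for `u ≥ 3/2`. -/
theorem le_phiNegLogDeriv₃ {u : ℝ} (hu : 3 / 2 ≤ u) :
    64 * π * rexp (4 * u) * (1 - 1 / 10 ^ 6) ≤ phiNegLogDeriv₃ u :=
  (phiNegLogDeriv₃₄_bounds hu).1.1

/-- (E4), lower: `256πe^{4u} ≤ ψ⁗(u)` for `u ≥ 3/2`. -/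
theorem le_phiNegLogDeriv₄ {u : ℝ} (hu : 3 / 2 ≤ u) : 256 * π * rexp (4 * u) ≤ phiNegLogDeriv₄ u :=
  (phiNegLogDeriv₃₄_bounds hu).2.1

/-- (E4), upper: `ψ⁗(u) ≤ 256πe^{4u}(1 + 10⁻⁶)` for `u ≥ 3/2`. -/
theorem phiNegLogDeriv₄_le {u : ℝ} (hu : 3 / 2 ≤ u) :
    phiNegLogDeriv₄ u ≤ 256 * π * rexp (4 * u) * (1 + 1 / 10 ^ 6) :=
  (phiNegLogDeriv₃₄_bounds hu).2.2

/-- In particular `ψ‴ > 0` and `ψ⁗ > 0` on `u ≥ 3/2`. -/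
theorem phiNegLogDeriv₃_pos {u : ℝ} (hu : 3 / 2 ≤ u) : 0 < phiNegLogDeriv₃ u := by
  have h := le_phiNegLogDeriv₃ hu
  have : 0 < 64 * π * rexp (4 * u) * (1 - 1 / 10 ^ 6) := by
    have := Real.pi_pos; have := Real.exp_pos (4 * u); positivity
  linarith

/-- `ψ⁗ > 0` on `u ≥ 3/2`. -/
theorem phiNegLogDeriv₄_pos {u : ℝ} (hu : 3 / 2 ≤ u) : 0 < phiNegLogDeriv₄ u := by
  have h := le_phiNegLogDeriv₄ hu
  have : 0 < 256 * π * rexp (4 * u) := by have := Real.pi_pos; positivity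
  linarith

/-- (E3) with the denominator cleared, for users of `Φ, Φ′, Φ″, Φ‴` directly:
`64πe^{4u}(1 − 10⁻⁶)Φ³ ≤ −Φ²Φ‴ + 3ΦΦ′Φ″ − 2Φ′³ ≤ 64πe^{4u}Φ³` (`u ≥ 3/2`). -/
theorem deBruijnPhi_logDeriv₃_bounds {u : ℝ} (hu : 3 / 2 ≤ u) :
    64 * π * rexp (4 * u) * (1 - 1 / 10 ^ 6) * deBruijnPhi u ^ 3 ≤
        -(deBruijnPhi u ^ 2 * deBruijnPhiDeriv₃ u) + 3 * deBruijnPhi u * deBruijnPhiDeriv u * deBruijnPhiDeriv₂ u -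
          2 * deBruijnPhiDeriv u ^ 3 ∧
      -(deBruijnPhi u ^ 2 * deBruijnPhiDeriv₃ u) + 3 * deBruijnPhi u * deBruijnPhiDeriv u * deBruijnPhiDeriv₂ u -
          2 * deBruijnPhiDeriv u ^ 3 ≤ 64 * π * rexp (4 * u) * deBruijnPhi u ^ 3 := by
  have hΦ3 : 0 < deBruijnPhi u ^ 3 := pow_pos (deBruijnPhi_pos_holds u) 3
  obtain ⟨⟨hl, hr⟩, -⟩ := phiNegLogDeriv₃₄_bounds hu
  rw [← phiNegLogDeriv₃_mul_pow]
  exact ⟨mul_le_mul_of_nonneg_right hl hΦ3.le, mul_le_mul_of_nonneg_right hr hΦ3.le⟩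

/-- (E4) with the denominator cleared:
`256πe^{4u}Φ⁴ ≤ 6Φ′⁴ − 12ΦΦ′²Φ″ + 3Φ²Φ″² + 4Φ²Φ′Φ‴ − Φ³Φ⁗ ≤ 256πe^{4u}(1 + 10⁻⁶)Φ⁴` (`u ≥ 3/2`). -/
theorem deBruijnPhi_logDeriv₄_bounds {u : ℝ} (hu : 3 / 2 ≤ u) :
    256 * π * rexp (4 * u) * deBruijnPhi u ^ 4 ≤
        6 * deBruijnPhiDeriv u ^ 4 - 12 * deBruijnPhi u * deBruijnPhiDeriv u ^ 2 * deBruijnPhiDeriv₂ u +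
          3 * deBruijnPhi u ^ 2 * deBruijnPhiDeriv₂ u ^ 2 +
          4 * deBruijnPhi u ^ 2 * deBruijnPhiDeriv u * deBruijnPhiDeriv₃ u - deBruijnPhi u ^ 3 * deBruijnPhiDeriv₄ u ∧
      6 * deBruijnPhiDeriv u ^ 4 - 12 * deBruijnPhi u * deBruijnPhiDeriv u ^ 2 * deBruijnPhiDeriv₂ u +
          3 * deBruijnPhi u ^ 2 * deBruijnPhiDeriv₂ u ^ 2 +
          4 * deBruijnPhi u ^ 2 * deBruijnPhiDeriv u * deBruijnPhiDeriv₃ u - deBruijnPhi u ^ 3 * deBruijnPhiDeriv₄ u ≤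
        256 * π * rexp (4 * u) * (1 + 1 / 10 ^ 6) * deBruijnPhi u ^ 4 := by
  have hΦ4 : 0 < deBruijnPhi u ^ 4 := pow_pos (deBruijnPhi_pos_holds u) 4
  obtain ⟨-, ⟨hl, hr⟩⟩ := phiNegLogDeriv₃₄_bounds hu
  rw [← phiNegLogDeriv₄_mul_pow]
  exact ⟨mul_le_mul_of_nonneg_right hl hΦ4.le, mul_le_mul_of_nonneg_right hr hΦ4.le⟩

end Summit.RiemannHypothesis.RiemannHypothesis.Theorems.JensenPolynomials

end
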